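import Mathlib.Topology.MetricSpace.HausdorffDimension
import Mathlib.MeasureTheory.Integral.Lebesgue.Markov
import Mathlib.MeasureTheory.Measure.Prod
import Mathlib.Analysis.SpecialFunctions.Pow.Continuity
import Mathlib.Analysis.SpecificLimits.Basic
import Literature.MeasureTheory.Hausdorff.EnergyMethod
import HarnessLib

/-!
# Ball contents, Riesz energies, and the energy (Frostman) lower bound for the Hausdorff dimension

Topic: measure theory / Hausdorff dimension. The **potential theoretic method** for lower bounds
of Hausdorff dimensions (Mattila (1995), Thm. 8.8 `(b) ⇒ (a)` with the energy version §8;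
Falconer (2014), Thm. 4.13): a set carrying a nonzero finite measure of finite Riesz `α`-energy
has `dim_H ≥ α` (`le_dimH_of_rieszEnergy_ne_top` of `EnergyMethod.lean`), here in a
**quantitative** form suited to random limit sets (`le_ballContent_of_rieszEnergy_le`: mass `≥ a` and energy `≤ L` give a lower bound
`contentConst α a L > 0`, depending on `(α, a, L)` only, for `∑ rᵢ^α` over every countable
cover by balls), together with the two continuity properties of the ball content used to pass
to a decreasing intersection of compact sets (`le_ballContent_iInter`) and to the Hausdorff
measure (`ballContent_le_two_rpow_mul_hausdorffMeasure`, `le_dimH_of_ballContent_pos`).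
Everything is `ℝ≥0∞`-valued and stated in an (extended) metric space; all results proved.

* `ballContent α S` — `inf ∑ rᵢ^α` over countable covers of `S` by open balls `B(cᵢ, rᵢ)`.
* the Riesz kernel / potential / energy `rieszKernel`, `rieszPotential`, `rieszEnergy` are those
  of `Literature/MeasureTheory/Hausdorff/EnergyMethod.lean` (qualitative energy method, Lawler's
  Lemma A.4), which this file complements by the quantitative content bound;
* `measure_eball_le_of_rieszPotential_le` — `U^μ_α(x) ≤ M ⇒ μ(B(x, r)) ≤ M r^α` (extended
  radii; the closed-ball / real-radius form is `measure_closedBall_le_of_rieszPotential_le` there).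
* `le_ballContent_of_rieszEnergy_le` — the quantitative energy method (Markov on the potential,
  ball growth on the good set, mass distribution over a cover).

Used by `Literature/Probability/RandomFractals/SecondMomentDimension.lean` (Beffara's
Proposition 1 (2), the second moment method for random fractals).

## Mathlib

We USE `MeasureTheory.Measure.hausdorffMeasure_apply`, `le_dimH_of_hausdorffMeasure_ne_zero`,
`meas_ge_le_lintegral_div` (Markov), `Measurable.lintegral_prod_right'`,
`exists_subset_nhds_of_isCompact'`, `Metric.eball_subset`, `ENNReal.le_of_forall_pos_le_add`,
`tsum_geometric_two'`. Mathlib has the mass distribution principle (`Measure.le_hausdorffMeasure`,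
cf. `Literature/MeasureTheory/Hausdorff/BallGrowthAbsCont.lean`) but neither Riesz energies nor
Frostman's lemma / the energy method (searched `Frostman`, `energy`, `rieszPotential`).

## References

* P. Mattila, *Geometry of Sets and Measures in Euclidean Spaces*, CUP (1995), §4.3 (contents),
  Ch. 8 (energies, Thm. 8.8, §8.8–8.9).
* K. Falconer, *Fractal Geometry*, 3rd ed., Wiley (2014), §4.3, Thm. 4.13 (potential theoretic
  methods).
-/

noncomputable section

open Set Filter Metric Function
open _root_.MeasureTheory _root_.MeasureTheory.Measure
open scoped ENNReal NNReal Topology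

namespace Literature.MeasureTheory.Hausdorff

variable {X : Type*} [MetricSpace X]

/-! ### The `α`-content by countable families of open balls -/

/-- The **`α`-content by balls** of `S`: the infimum of `∑ᵢ rᵢ ^ α` over the countable families of
open balls `B(cᵢ, rᵢ)` covering `S` (radii in `ℝ≥0∞`; a comparable variant of the Hausdorff
content `𝓗^α_∞`, Mattila (1995), §4.3 / Falconer (2014), §3.2). [folklore] -/
def ballContent (α : ℝ) (S : Set X) : ℝ≥0∞ :=
  ⨅ (c : ℕ → X) (r : ℕ → ℝ≥0∞) (_ : S ⊆ ⋃ i, eball (c i) (r i)), ∑' i, r i ^ α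

/-- A covering family of balls bounds the ball content. [folklore] -/
theorem ballContent_le_tsum {α : ℝ} {S : Set X} {c : ℕ → X} {r : ℕ → ℝ≥0∞}
    (h : S ⊆ ⋃ i, eball (c i) (r i)) : ballContent α S ≤ ∑' i, r i ^ α :=
  iInf_le_of_le c (iInf_le_of_le r (iInf_le_of_le h le_rfl))

/-- The ball content is monotone. [folklore] -/
theorem ballContent_mono {α : ℝ} {S T : Set X} (h : S ⊆ T) : ballContent α S ≤ ballContent α T :=
  le_iInf fun _ ↦ le_iInf fun _ ↦ le_iInf fun hT ↦ ballContent_le_tsum (h.trans hT)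

/-- An elementary inequality in `ℝ≥0∞`: `(a + b) ^ α ≤ 2 ^ α (a ^ α + b ^ α)` (`α ≥ 0`). [folklore] -/
theorem ENNReal.add_rpow_le_two_rpow_mul {a b : ℝ≥0∞} {α : ℝ} (hα : 0 ≤ α) :
    (a + b) ^ α ≤ 2 ^ α * (a ^ α + b ^ α) := by
  rcases le_total a b with hab | hab
  · calc (a + b) ^ α ≤ (2 * b) ^ α := ENNReal.rpow_le_rpow (by rw [two_mul]; gcongr) hα
      _ = 2 ^ α * b ^ α := ENNReal.mul_rpow_of_nonneg _ _ hα
      _ ≤ 2 ^ α * (a ^ α + b ^ α) := by gcongr; exact le_add_self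
  · calc (a + b) ^ α ≤ (2 * a) ^ α := ENNReal.rpow_le_rpow (by rw [two_mul]; gcongr) hα
      _ = 2 ^ α * a ^ α := ENNReal.mul_rpow_of_nonneg _ _ hα
      _ ≤ 2 ^ α * (a ^ α + b ^ α) := by gcongr; exact le_self_add

/-- **The ball content is dominated by the Hausdorff measure**: `ballContent α S ≤ 2^α μH[α] S`
(`α > 0`): a countable cover by sets `tᵢ` of small `∑ diam(tᵢ)^α` (definition of `μH`) is
enlarged to the open balls `B(xᵢ, diam tᵢ + θᵢ)`, `xᵢ ∈ tᵢ`, `∑ θᵢ^α` small. In particular a set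
of positive ball content has positive `μH[α]`-measure. [folklore] -/
theorem ballContent_le_two_rpow_mul_hausdorffMeasure [MeasurableSpace X] [BorelSpace X] [Nonempty X]
    {α : ℝ} (hα : 0 < α) (S : Set X) : ballContent α S ≤ 2 ^ α * μH[α] S := by
  obtain ⟨x₀⟩ := ‹Nonempty X›
  classical
  refine ENNReal.le_of_forall_pos_le_add fun ε hε hfin ↦ ?_
  have h2 : (2 : ℝ≥0∞) ^ α ≠ 0 := by simp
  have h2' : (2 : ℝ≥0∞) ^ α ≠ ⊤ := by simp
  have hμ : μH[α] S ≠ ⊤ := by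
    intro h
    rw [h, ENNReal.mul_top h2] at hfin
    exact lt_irrefl _ hfin
  -- the slack
  set δ : ℝ≥0∞ := (ε : ℝ≥0∞) / (2 * 2 ^ α) with hδ
  have hδ0 : δ ≠ 0 := by
    rw [hδ]
    exact (ENNReal.div_pos (by exact_mod_cast hε.ne') (ENNReal.mul_ne_top (by simp) h2')).ne'
  have hδε : 2 ^ α * (δ + δ) = ε := by
    rw [hδ, ← two_mul, ← mul_assoc, mul_comm (2 ^ α) 2,
      ENNReal.mul_div_cancel (mul_ne_zero two_ne_zero h2) (ENNReal.mul_ne_top (by simp) h2')]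
  -- Step 1: a countable cover with `∑ diam^α < μH + δ`
  obtain ⟨t, htS, htd, hsum⟩ : ∃ t : ℕ → Set X, S ⊆ ⋃ n, t n ∧ (∀ n, ediam (t n) ≤ 1) ∧
      ∑' n, ⨆ _ : (t n).Nonempty, ediam (t n) ^ α < μH[α] S + δ := by
    have hle : (⨅ (t : ℕ → Set X) (_ : S ⊆ ⋃ n, t n) (_ : ∀ n, ediam (t n) ≤ (1 : ℝ≥0∞)),
        ∑' n, ⨆ _ : (t n).Nonempty, ediam (t n) ^ α) ≤ μH[α] S := by
      rw [hausdorffMeasure_apply]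
      exact le_iSup₂ (f := fun (r : ℝ≥0∞) (_ : 0 < r) ↦ ⨅ (t : ℕ → Set X) (_ : S ⊆ ⋃ n, t n)
        (_ : ∀ n, ediam (t n) ≤ r), ∑' n, ⨆ _ : (t n).Nonempty, ediam (t n) ^ α) 1 one_pos
    have hlt : (⨅ (t : ℕ → Set X) (_ : S ⊆ ⋃ n, t n) (_ : ∀ n, ediam (t n) ≤ (1 : ℝ≥0∞)),
        ∑' n, ⨆ _ : (t n).Nonempty, ediam (t n) ^ α) < μH[α] S + δ :=
      lt_of_le_of_lt hle (ENNReal.lt_add_right hμ hδ0)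
    simp only [iInf_lt_iff] at hlt
    obtain ⟨t, htS, htd, hsum⟩ := hlt
    exact ⟨t, htS, htd, hsum⟩
  -- Step 2: enlarge to open balls
  set θr : ℕ → ℝ := fun n ↦ (δ.toReal / 2 / 2 ^ n) ^ (1 / α) with hθr
  have hδr : 0 ≤ δ.toReal := ENNReal.toReal_nonneg
  have hθr0 : ∀ n, 0 ≤ θr n := fun n ↦ Real.rpow_nonneg (by positivity) _
  set θ : ℕ → ℝ≥0∞ := fun n ↦ ENNReal.ofReal (θr n) with hθ
  have hθα : ∀ n, θ n ^ α = ENNReal.ofReal (δ.toReal / 2 / 2 ^ n) := by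
    intro n
    rw [hθ, ENNReal.ofReal_rpow_of_nonneg (hθr0 n) hα.le, hθr, ← Real.rpow_mul (by positivity),
      one_div_mul_cancel hα.ne', Real.rpow_one]
  have hθsum : ∑' n, θ n ^ α = δ := by
    have hδtop : δ ≠ ⊤ := ENNReal.div_ne_top ENNReal.coe_ne_top (mul_ne_zero two_ne_zero h2)
    simp only [hθα]
    rw [← ENNReal.ofReal_tsum_of_nonneg (fun n ↦ by positivity) (summable_geometric_two' _),
      tsum_geometric_two', ENNReal.ofReal_toReal hδtop]
  -- positivity of the slack radii needs `δ.toReal > 0`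
  have hδtop : δ ≠ ⊤ := ENNReal.div_ne_top ENNReal.coe_ne_top (mul_ne_zero two_ne_zero h2)
  have hδr0 : 0 < δ.toReal := ENNReal.toReal_pos hδ0 hδtop
  have hθ0 : ∀ n, 0 < θ n := fun n ↦ by
    rw [hθ, ENNReal.ofReal_pos, hθr]
    exact Real.rpow_pos_of_pos (by positivity) _
  set xc : ℕ → X := fun n ↦ if h : (t n).Nonempty then h.some else x₀ with hxc
  set ρ : ℕ → ℝ≥0∞ := fun n ↦ ediam (t n) + θ n with hρ
  have hcover : S ⊆ ⋃ n, eball (xc n) (ρ n) := by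
    refine htS.trans (iUnion_mono fun n y hy ↦ ?_)
    have hne : (t n).Nonempty := ⟨y, hy⟩
    have hx : xc n ∈ t n := by
      simp only [hxc, dif_pos hne]
      exact hne.some_mem
    rw [mem_eball]
    calc edist y (xc n) ≤ ediam (t n) := edist_le_ediam_of_mem hy hx
      _ < ediam (t n) + θ n := ENNReal.lt_add_right
          (ne_top_of_le_ne_top ENNReal.one_ne_top (htd n)) (hθ0 n).ne'
  -- Step 3: the estimate
  have hterm : ∀ n, ediam (t n) ^ α = ⨆ _ : (t n).Nonempty, ediam (t n) ^ α := by
    intro n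
    rcases (t n).eq_empty_or_nonempty with he | hne
    · simp [he, ENNReal.zero_rpow_of_pos hα]
    · rw [iSup_pos hne]
  calc ballContent α S ≤ ∑' n, ρ n ^ α := ballContent_le_tsum hcover
    _ ≤ ∑' n, 2 ^ α * (ediam (t n) ^ α + θ n ^ α) :=
        ENNReal.tsum_le_tsum fun n ↦ ENNReal.add_rpow_le_two_rpow_mul hα.le
    _ = 2 ^ α * (∑' n, ediam (t n) ^ α + ∑' n, θ n ^ α) := by
        rw [ENNReal.tsum_mul_left, ENNReal.tsum_add]
    _ ≤ 2 ^ α * ((μH[α] S + δ) + δ) := by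
        gcongr
        · calc ∑' n, ediam (t n) ^ α = ∑' n, ⨆ _ : (t n).Nonempty, ediam (t n) ^ α :=
              tsum_congr hterm
            _ ≤ μH[α] S + δ := hsum.le
        · exact hθsum.le
    _ = 2 ^ α * μH[α] S + ε := by rw [add_assoc, mul_add, hδε]

/-- Positive ball content forces positive Hausdorff measure, hence `α ≤ dim_H S`. [folklore] -/
theorem le_dimH_of_ballContent_pos [MeasurableSpace X] [BorelSpace X] [Nonempty X] {α : ℝ}
    (hα : 0 < α) {S : Set X} (h : 0 < ballContent α S) : ENNReal.ofReal α ≤ dimH S := by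
  have hH : μH[α] S ≠ 0 := by
    intro h0
    have := ballContent_le_two_rpow_mul_hausdorffMeasure hα S
    rw [h0, mul_zero] at this
    exact (not_lt_of_ge this) h
  exact le_dimH_of_hausdorffMeasure_ne_zero (d := α.toNNReal) (by rwa [Real.coe_toNNReal _ hα.le])

/-- **Contents of decreasing compact sets pass to the intersection**: if `C₀ ⊇ C₁ ⊇ ⋯` are
compact and every `Cₙ` has ball content `≥ c`, so has `⋂ₙ Cₙ` — an open cover of the
intersection already covers some `Cₙ` (Mathlib `exists_subset_nhds_of_isCompact'`). [folklore] -/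
theorem le_ballContent_iInter {α : ℝ} {C : ℕ → Set X} (hC : ∀ n, IsCompact (C n))
    (hanti : Antitone C) {c : ℝ≥0∞} (h : ∀ n, c ≤ ballContent α (C n)) :
    c ≤ ballContent α (⋂ n, C n) := by
  refine le_iInf fun x ↦ le_iInf fun r ↦ le_iInf fun hcov ↦ ?_
  have hdir : Directed (· ⊇ ·) C := fun m n ↦
    ⟨max m n, hanti (le_max_left m n), hanti (le_max_right m n)⟩
  have hopen : IsOpen (⋃ i, eball (x i) (r i)) := isOpen_iUnion fun i ↦ isOpen_eball
  obtain ⟨n, hn⟩ := exists_subset_nhds_of_isCompact' hdir hC (fun n ↦ (hC n).isClosed)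
    (fun y hy ↦ hopen.mem_nhds (hcov hy))
  exact (h n).trans (ballContent_le_tsum hn)

/-! ### Riesz kernels, potentials and energies: ball growth and the content bound -/

/-- On the ball `B(x, r)` (extended radius) the Riesz kernel `rieszKernel α x y = d(x, y)^{-α}`
of `EnergyMethod.lean` is at least `(r ^ α)⁻¹` (`α ≥ 0`). [folklore] -/
theorem inv_rpow_le_rieszKernel {α : ℝ} (hα : 0 ≤ α) {x y : X} {r : ℝ≥0∞}
    (hy : y ∈ eball x r) : (r ^ α)⁻¹ ≤ rieszKernel α x y := by
  rw [mem_eball, edist_comm] at hy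
  rw [rieszKernel, ← ENNReal.inv_rpow]
  exact ENNReal.rpow_le_rpow (ENNReal.inv_le_inv.2 hy.le) hα

variable [MeasurableSpace X] [BorelSpace X]

/-- **Ball growth from a potential bound**: `U^μ_α(x) ≤ M` implies `μ(B(x, r)) ≤ M r^α`
(`α > 0`, `r < ∞`), since the kernel is `≥ r^{-α}` on `B(x, r)`. Mattila (1995), proof of
Thm. 8.8. [folklore] -/
theorem measure_eball_le_of_rieszPotential_le {α : ℝ} (hα : 0 < α) {μ : Measure X} {x : X}
    {M : ℝ≥0∞} (h : rieszPotential α μ x ≤ M) {r : ℝ≥0∞} (hr : r ≠ ⊤) :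
    μ (eball x r) ≤ M * r ^ α := by
  rcases eq_or_ne r 0 with rfl | hr0
  · have he : eball x (0 : ℝ≥0∞) = ∅ := by
      ext y
      simp
    simp [he]
  have h0 : r ^ α ≠ 0 := by
    rw [Ne, ENNReal.rpow_eq_zero_iff]
    push Not
    exact ⟨fun h ↦ absurd h hr0, fun h ↦ absurd h hr⟩
  have htop : r ^ α ≠ ⊤ := by
    rw [Ne, ENNReal.rpow_eq_top_iff]
    push Not
    exact ⟨fun h ↦ absurd h hr0, fun h ↦ absurd h hr⟩
  have hint : (r ^ α)⁻¹ * μ (eball x r) ≤ M := by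
    calc (r ^ α)⁻¹ * μ (eball x r)
        = ∫⁻ _ in eball x r, (r ^ α)⁻¹ ∂μ := (setLIntegral_const _ _).symm
      _ ≤ ∫⁻ y in eball x r, rieszKernel α x y ∂μ :=
          setLIntegral_mono' isOpen_eball.measurableSet fun y hy ↦
            inv_rpow_le_rieszKernel hα.le hy
      _ ≤ rieszPotential α μ x := setLIntegral_le_lintegral _ _
      _ ≤ M := h
  rw [ENNReal.inv_mul_le_iff h0 htop] at hint
  rwa [mul_comm] at hint

/-- The **content constant** `c(α, a, L) = (a/2) / (((2L + a)/a) · 2^α)`: a lower bound for the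
`α`-ball content of any set carrying a measure of mass `≥ a` and `α`-energy `≤ L`
(`le_ballContent_of_rieszEnergy_le`); positive and depending on `(α, a, L)` only. [folklore] -/
def contentConst (α : ℝ) (a L : ℝ≥0∞) : ℝ≥0∞ :=
  a / 2 / ((2 * L + a) / a * 2 ^ α)

/-- The content constant is positive for `a ∈ (0, ∞)` and `L < ∞`. [folklore] -/
theorem contentConst_pos (α : ℝ) {a L : ℝ≥0∞} (ha0 : a ≠ 0) (hat : a ≠ ⊤) (hL : L ≠ ⊤) :
    0 < contentConst α a L := by
  rw [contentConst]
  refine ENNReal.div_pos (ENNReal.div_pos ha0 ENNReal.ofNat_ne_top).ne' ?_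
  refine ENNReal.mul_ne_top (ENNReal.div_ne_top ?_ ha0) (by simp)
  exact ENNReal.add_ne_top.2 ⟨ENNReal.mul_ne_top ENNReal.ofNat_ne_top hL, hat⟩

/-- **The energy method (Frostman-type lower bound), quantitative form.** Let `μ` be a finite
measure on `X` with `μ(X) ≥ a > 0` and Riesz energy `I_α(μ) ≤ L < ∞` (`α > 0`), and let `S`
carry `μ` (`μ(Sᶜ) = 0`). Then every countable cover of `S` by open balls `B(cᵢ, rᵢ)` has
`∑ rᵢ^α ≥ c(α, a, L) > 0`, i.e. `ballContent α S ≥ contentConst α a L`. Proof: with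
`M = (2L + a)/a`, the set `G = {U^μ_α ≤ M}` has `μ(G) ≥ a/2` (Markov), balls centred in `G`
have `μ(B(z, ρ)) ≤ M ρ^α` (`measure_eball_le_of_rieszPotential_le`), and a ball of the cover
meeting `G` at `z` lies in `B(z, 2rᵢ)`. Mattila (1995), Thm. 8.8 `(b) ⇒ (a)` / Falconer (2014),
Thm. 4.13 (potential theoretic method). [folklore] -/
theorem le_ballContent_of_rieszEnergy_le [SecondCountableTopology X] {α : ℝ} (hα : 0 < α) {μ : Measure X} [IsFiniteMeasure μ]
    {a L : ℝ≥0∞} (ha0 : a ≠ 0) (ha : a ≤ μ univ) (hLtop : L ≠ ⊤) (hL : rieszEnergy α μ ≤ L)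
    {S : Set X} (hS : μ Sᶜ = 0) :
    contentConst α a L ≤ ballContent α S := by
  have hatop : a ≠ ⊤ := ne_top_of_le_ne_top (measure_ne_top μ univ) ha
  have h2La : 2 * L + a ≠ ⊤ :=
    ENNReal.add_ne_top.2 ⟨ENNReal.mul_ne_top ENNReal.ofNat_ne_top hLtop, hatop⟩
  set M : ℝ≥0∞ := (2 * L + a) / a with hM
  have hM0 : M ≠ 0 := (ENNReal.div_pos (by positivity) hatop).ne'
  have hMtop : M ≠ ⊤ := ENNReal.div_ne_top h2La ha0
  -- the good set
  set G : Set X := {x | rieszPotential α μ x ≤ M} with hG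
  have hpot := measurable_rieszPotential α μ
  -- Markov: `μ Gᶜ ≤ a / 2`
  have hGc : μ Gᶜ ≤ a / 2 := by
    have h1 : μ {x | M ≤ rieszPotential α μ x} ≤ (∫⁻ x, rieszPotential α μ x ∂μ) / M :=
      meas_ge_le_lintegral_div hpot.aemeasurable hM0 hMtop
    have hsub : Gᶜ ⊆ {x | M ≤ rieszPotential α μ x} := fun x hx ↦ by
      simp only [hG, mem_compl_iff, mem_setOf_eq, not_le] at hx
      exact hx.le
    calc μ Gᶜ ≤ μ {x | M ≤ rieszPotential α μ x} := measure_mono hsub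
      _ ≤ (∫⁻ x, rieszPotential α μ x ∂μ) / M := h1
      _ ≤ L / M := by
          gcongr
          exact hL
      _ ≤ a / 2 := by
          refine ENNReal.div_le_of_le_mul ?_
          -- `L ≤ a / 2 * M = (2L + a) / 2`
          have hcalc : a / 2 * M = (2 * L + a) / 2 := by
            rw [hM, div_eq_mul_inv, div_eq_mul_inv, div_eq_mul_inv]
            calc a * 2⁻¹ * ((2 * L + a) * a⁻¹) = (a * a⁻¹) * ((2 * L + a) * 2⁻¹) := by ring
              _ = (2 * L + a) * 2⁻¹ := by rw [ENNReal.mul_inv_cancel ha0 hatop, one_mul]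
          rw [hcalc]
          calc L = 2 * L / 2 := by
                rw [mul_comm, ENNReal.mul_div_cancel_right two_ne_zero ENNReal.ofNat_ne_top]
            _ ≤ (2 * L + a) / 2 := by
                gcongr
                exact le_self_add
  have hGge : a / 2 ≤ μ G := by
    have h1 : a ≤ μ G + a / 2 :=
      calc a ≤ μ univ := ha
        _ ≤ μ G + μ Gᶜ := measure_univ_le_add_compl G
        _ ≤ μ G + a / 2 := by gcongr
    calc a / 2 = a - a / 2 := (ENNReal.sub_half hatop).symm
      _ ≤ μ G := tsub_le_iff_right.2 h1
  -- ball growth at good points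
  have hgrowth : ∀ z ∈ G, ∀ ρ : ℝ≥0∞, ρ ≠ ⊤ → μ (eball z ρ) ≤ M * ρ ^ α :=
    fun z hz ρ hρ ↦ measure_eball_le_of_rieszPotential_le hα hz hρ
  -- covers
  refine le_iInf fun c ↦ le_iInf fun r ↦ le_iInf fun hcov ↦ ?_
  by_cases htop : ∃ i, r i = ⊤
  · obtain ⟨i, hi⟩ := htop
    calc contentConst α a L ≤ ⊤ := le_top
      _ = r i ^ α := by rw [hi, ENNReal.top_rpow_of_pos hα]
      _ ≤ ∑' i, r i ^ α := ENNReal.le_tsum i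
  push Not at htop
  have hpiece : ∀ i, μ (G ∩ eball (c i) (r i)) ≤ M * 2 ^ α * r i ^ α := by
    intro i
    rcases (G ∩ eball (c i) (r i)).eq_empty_or_nonempty with he | ⟨z, hzG, hz⟩
    · simp [he]
    · have hzc : edist (c i) z < r i := by
        rw [edist_comm]
        exact hz
      have hsub : eball (c i) (r i) ⊆ eball z (2 * r i) := by
        refine eball_subset ?_ hzc.ne_top
        rw [two_mul]
        gcongr
      calc μ (G ∩ eball (c i) (r i)) ≤ μ (eball z (2 * r i)) :=
            measure_mono (inter_subset_right.trans hsub)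
        _ ≤ M * (2 * r i) ^ α :=
            hgrowth z hzG _ (ENNReal.mul_ne_top ENNReal.ofNat_ne_top (htop i))
        _ = M * 2 ^ α * r i ^ α := by rw [ENNReal.mul_rpow_of_nonneg _ _ hα.le, mul_assoc]
  -- summing over the cover
  have hsum : a / 2 ≤ M * 2 ^ α * ∑' i, r i ^ α := by
    calc a / 2 ≤ μ G := hGge
      _ ≤ μ (G ∩ S) + μ Sᶜ := by
          calc μ G ≤ μ ((G ∩ S) ∪ Sᶜ) := measure_mono fun x hx ↦ by
                by_cases hxS : x ∈ S
                · exact Or.inl ⟨hx, hxS⟩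
                · exact Or.inr hxS
            _ ≤ μ (G ∩ S) + μ Sᶜ := measure_union_le _ _
      _ = μ (G ∩ S) := by rw [hS, add_zero]
      _ ≤ μ (⋃ i, G ∩ eball (c i) (r i)) := measure_mono fun x ⟨hxG, hxS⟩ ↦ by
          obtain ⟨i, hi⟩ := mem_iUnion.1 (hcov hxS)
          exact mem_iUnion.2 ⟨i, hxG, hi⟩
      _ ≤ ∑' i, μ (G ∩ eball (c i) (r i)) := measure_iUnion_le _
      _ ≤ ∑' i, M * 2 ^ α * r i ^ α := ENNReal.tsum_le_tsum hpiece
      _ = M * 2 ^ α * ∑' i, r i ^ α := ENNReal.tsum_mul_left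
  rw [contentConst]
  exact ENNReal.div_le_of_le_mul' hsum

end Literature.MeasureTheory.Hausdorff


end
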